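import Literature.AnabelianGeometry.SemiGraphs.ChartFiniteObjects
import Literature.AnabelianGeometry.SemiGraphs.TemperedVerticialExistsProofs
import Literature.AnabelianGeometry.SemiGraphs.TemperoidsHomEqResProofs
import Literature.AnabelianGeometry.Anabelioids.BCatCompletion
import HarnessLib

/-!
# [SemiAnbd] Prop. 3.6 (iii): `π̂₁(B(𝒢))` (chart basepoint) is the profinite completion of `π₁^temp(𝒢)`

Mochizuki, *Semi-graphs of anabelioids*, Publ. RIMS **42** (2006), Prop. 3.6 (iii) p. 38: "The full
embedding `B(G) ↪ B^temp(G)` induces an injection `π₁^temp(G) ↪ π̂₁(G)` of topological groups"; the tree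
reads `π̂₁(G)` as the profinite completion of `π₁^temp(G)` (the finite objects of `B^temp(G)` are the finite
étale coverings) and types the injectivity as residual finiteness (`TemperedPiResiduallyFinite`)
[cite: MochizukiSemiAnbd2006, Prop 3.6(iii) p.38].  This proof-only sequel to
`ChartFibreFunctor(Fin).lean` / `ChartFiniteObjects.lean` (abc-iut L3, B7b part 2c) proves the two
clauses that make `Aut(chart basepoint)` the profinite completion, by transport of the corresponding
clauses for `B(π₁^temp(𝒢))` (`exists_completion_aut_forget`, `BCatCompletion.lean`) along
`chartToBObj` / `chartFibreToBObjIso`: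

* `chartActionFin_eq_one_iff` — `g` acts trivially on every finite étale covering iff `g` lies in every
  open normal subgroup of finite index of `π₁^temp(𝒢)` (KERNEL = residually-finite kernel; so
  `π₁^temp(𝒢) → π̂₁(B(𝒢))` is injective iff `π₁^temp(𝒢)` is residually finite);
* `chartActionFin_dense` — every automorphism of the chart basepoint is matched by some
  `g ∈ π₁^temp(𝒢)` on any finitely many finite étale coverings (DENSE IMAGE);
* `exists_profiniteCompletion_chart` — ASSEMBLY under the hypotheses of Prop. 3.6
  (`Prop36Hypotheses`: the verticial homomorphism comes from Thm. 3.7 (i) `exists_isVerticialHom_of` +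
  `TemperoidHomEqRes_holds`, finiteness ⇒ temperedness from `FiniteIsTempered_holds`): for every chart
  `c` there are a fibre functor `Φ` of `B(𝒢.toAnab)` and a continuous `ι : π₁^temp(𝒢) → Aut Φ` with the
  residually-finite kernel and dense image.

Nothing here takes a side on [IUTchIII] Cor. 3.12.
-/

noncomputable section

namespace Literature.AnabelianGeometry.SemiGraphs

open CategoryTheory CategoryTheory.Limits CategoryTheory.PreGaloisCategory
open Literature.AnabelianGeometry.Anabelioids
open Literature.AlgebraicGeometry.Frobenioids (BCat)
open scoped FintypeCatDiscrete Pointwise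

universe u

namespace ProfiniteSemiGraph

variable {𝒢 : ProfiniteSemiGraph.{u}}
variable (c : TemperedPiChart 𝒢) (h𝒢 : ∀ S : CovObj 𝒢, S.IsFinite → S.IsTempered)

/-! ### Kernel -/

/-- If `g ∈ π₁^temp(𝒢)` acts trivially on every FINITE continuous `π₁^temp(𝒢)`-set, it acts trivially on
the chart fibre of every finite étale covering (transport along `chartToBObj (c X) ≅ X` and the
equivariant `chartFibreToBObjIso`). [cite: MochizukiSemiAnbd2006, Prop 3.6(iii) p.38] -/
theorem chartAction_apply_eq_self_of (d : ChartVertexDatum c)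
    (hfin : ∀ X : 𝒢.toAnab.BObj, Finite ((chartFibre c h𝒢).obj X)) (g : c.G)
    (hg : ∀ (Y : BCat c.G) (y : Y.obj.V), ConcreteCategory.hom (Y.obj.ρ g) y = y) (X : 𝒢.toAnab.BObj)
    (x : (chartFibre c h𝒢).obj X) : (chartAction c h𝒢 g).hom.app X x = x := by
  -- move `x` to the chart fibre of `chartToBObj (c X)` along `α : chartToBObj (c X) ≅ X`
  have hx : (chartFibre c h𝒢).map (chartToBObjObjIso c h𝒢 hfin d X).hom
      ((chartFibre c h𝒢).map (chartToBObjObjIso c h𝒢 hfin d X).inv x) = x :=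
    ConcreteCategory.congr_hom ((chartToBObjObjIso c h𝒢 hfin d X).map_inv_hom_id (chartFibre c h𝒢)) x
  -- there `g` acts trivially: apply the equivariant `J` and use `hg`
  have hz : ∀ z : (chartFibre c h𝒢).obj ((chartToBObj c d).obj (chartFibreObj c h𝒢 hfin X)),
      (chartAction c h𝒢 g).hom.app _ z = z := fun z => by
    have h3 : (chartFibreToBObjIso c h𝒢 d).hom.app _ ((chartAction c h𝒢 g).hom.app _ z) =
        (chartFibreToBObjIso c h𝒢 d).hom.app _ z :=
      (chartFibreToBObjIso_equivariant c h𝒢 d g (chartFibreObj c h𝒢 hfin X) z).trans (hg _ _)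
    exact ((Iso.hom_inv_id_app_apply (chartFibreToBObjIso c h𝒢 d) _
        ((chartAction c h𝒢 g).hom.app _ z)).symm.trans
      ((congrArg ((chartFibreToBObjIso c h𝒢 d).inv.app (chartFibreObj c h𝒢 hfin X)) h3).trans
        (Iso.hom_inv_id_app_apply (chartFibreToBObjIso c h𝒢 d) _ z)))
  calc (chartAction c h𝒢 g).hom.app X x
      = (chartAction c h𝒢 g).hom.app X ((chartFibre c h𝒢).map (chartToBObjObjIso c h𝒢 hfin d X).hom
          ((chartFibre c h𝒢).map (chartToBObjObjIso c h𝒢 hfin d X).inv x)) := by rw [hx]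
    _ = (chartFibre c h𝒢).map (chartToBObjObjIso c h𝒢 hfin d X).hom
          ((chartAction c h𝒢 g).hom.app _
            ((chartFibre c h𝒢).map (chartToBObjObjIso c h𝒢 hfin d X).inv x)) :=
        NatTrans.naturality_apply (chartAction c h𝒢 g).hom (chartToBObjObjIso c h𝒢 hfin d X).hom _
    _ = (chartFibre c h𝒢).map (chartToBObjObjIso c h𝒢 hfin d X).hom
          ((chartFibre c h𝒢).map (chartToBObjObjIso c h𝒢 hfin d X).inv x) := congrArg _ (hz _)
    _ = x := hx

/-- Conversely, if `g` acts trivially on the chart fibres of all finite étale coverings, it acts trivially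
on every finite continuous `π₁^temp(𝒢)`-set (`Y ≅` the chart fibre of `chartToBObj Y`, equivariantly).
[cite: MochizukiSemiAnbd2006, Prop 3.6(iii) p.38] -/
theorem smul_eq_self_of_chartAction (d : ChartVertexDatum c) (g : c.G)
    (hg : ∀ (X : 𝒢.toAnab.BObj) (x : (chartFibre c h𝒢).obj X), (chartAction c h𝒢 g).hom.app X x = x)
    (Y : BCat c.G) (y : Y.obj.V) : ConcreteCategory.hom (Y.obj.ρ g) y = y := by
  have hy : (chartFibreToBObjIso c h𝒢 d).hom.app Y ((chartFibreToBObjIso c h𝒢 d).inv.app Y y) = y :=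
    Iso.inv_hom_id_app_apply (chartFibreToBObjIso c h𝒢 d) Y y
  have h1 := chartFibreToBObjIso_equivariant c h𝒢 d g Y ((chartFibreToBObjIso c h𝒢 d).inv.app Y y)
  rw [hg, hy] at h1
  exact h1.symm

/-- **KERNEL** ([SemiAnbd] Prop. 3.6 (iii) reading): `g ∈ π₁^temp(𝒢)` acts trivially on the chart
basepoint of `B(𝒢)` iff `g` lies in every open normal subgroup of finite index — so `π₁^temp(𝒢) →
π̂₁(B(𝒢))` has the residually-finite kernel, and is injective iff `π₁^temp(𝒢)` is residually finite
(`TemperedPiResiduallyFinite`). [cite: MochizukiSemiAnbd2006, Prop 3.6(iii) p.38] -/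
theorem chartActionFin_eq_one_iff (d : ChartVertexDatum c)
    (hfin : ∀ X : 𝒢.toAnab.BObj, Finite ((chartFibre c h𝒢).obj X)) (g : c.G) :
    chartActionFin c h𝒢 hfin g = 1 ↔
      ∀ N : OpenNormalSubgroup c.G, Finite (c.G ⧸ N.toSubgroup) → g ∈ N.toSubgroup := by
  obtain ⟨ι, hι, hker, -, -⟩ := exists_completion_aut_forget (G := c.G)
  rw [← hker g]
  constructor
  · intro h1
    have hg : ∀ (X : 𝒢.toAnab.BObj) (x : (chartFibre c h𝒢).obj X),
        (chartAction c h𝒢 g).hom.app X x = x := fun X x => by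
      have := congrArg (fun σ : Aut (chartFibreFin c h𝒢 hfin) => (σ.hom.app X : _ → _) x) h1
      exact this
    apply Iso.ext
    apply NatTrans.ext
    funext Y
    rw [hι]
    apply ConcreteCategory.hom_ext
    intro y
    exact smul_eq_self_of_chartAction c h𝒢 d g hg Y y
  · intro h1
    have hg : ∀ (Y : BCat c.G) (y : Y.obj.V), ConcreteCategory.hom (Y.obj.ρ g) y = y := fun Y y => by
      have h2 : (ι g).hom.app Y = 𝟙 _ := by
        rw [h1]
        rfl
      rw [hι] at h2
      exact ConcreteCategory.congr_hom h2 y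
    apply Iso.ext
    apply NatTrans.ext
    funext X
    apply ConcreteCategory.hom_ext
    intro x
    exact chartAction_apply_eq_self_of c h𝒢 d hfin g hg X x

/-! ### Density -/

/-- An automorphism `σ` of the chart basepoint, read on finite continuous `π₁^temp(𝒢)`-sets: conjugate
`chartToBObj ◁ σ` by `chartFibreToBObjIso` and descend along the fully faithful `incl` — an
automorphism of the forgetful basepoint of `B(π₁^temp(𝒢))`, `y ↦ J (σ (J⁻¹ y))`.
[cite: MochizukiSemiAnbd2006, Prop 3.6(iii) p.38] -/
def transportAutIso (d : ChartVertexDatum c) (hfin : ∀ X : 𝒢.toAnab.BObj, Finite ((chartFibre c h𝒢).obj X))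
    (σ : Aut (chartFibreFin c h𝒢 hfin)) :
    Aut (ObjectProperty.ι (Action.IsContinuous (V := FintypeCat.{u}) (G := c.G)) ⋙
      Action.forget FintypeCat.{u} c.G) :=
  ((ObjectProperty.fullyFaithfulι (fun X : Type u => Finite X)).whiskeringRight (BCat c.G)).preimageIso
    ((chartFibreToBObjIso c h𝒢 d).symm ≪≫
      Functor.isoWhiskerLeft (chartToBObj c d) (Functor.isoWhiskerRight σ FintypeCat.incl) ≪≫
      chartFibreToBObjIso c h𝒢 d)

/-- Components of `transportAutIso σ`: `y ↦ J (σ (J⁻¹ y))`. [cite: MochizukiSemiAnbd2006, Prop 3.6(iii) p.38] -/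
theorem transportAutIso_hom_app_apply (d : ChartVertexDatum c)
    (hfin : ∀ X : 𝒢.toAnab.BObj, Finite ((chartFibre c h𝒢).obj X))
    (σ : Aut (chartFibreFin c h𝒢 hfin)) (Y : BCat c.G) (y : Y.obj.V) :
    (transportAutIso c h𝒢 d hfin σ).hom.app Y y =
      (chartFibreToBObjIso c h𝒢 d).hom.app Y
        (σ.hom.app ((chartToBObj c d).obj Y) ((chartFibreToBObjIso c h𝒢 d).inv.app Y y)) := rfl

/-- **DENSE IMAGE** ([SemiAnbd] Prop. 3.6 (iii) reading): every automorphism of the chart basepoint of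
`B(𝒢)` agrees with the action of some `g ∈ π₁^temp(𝒢)` on any finitely many finite étale coverings.
[cite: MochizukiSemiAnbd2006, Prop 3.6(iii) p.38] -/
theorem chartActionFin_dense (d : ChartVertexDatum c)
    (hfin : ∀ X : 𝒢.toAnab.BObj, Finite ((chartFibre c h𝒢).obj X))
    (σ : Aut (chartFibreFin c h𝒢 hfin)) (S : Finset 𝒢.toAnab.BObj) :
    ∃ g : c.G, ∀ X ∈ S, (chartActionFin c h𝒢 hfin g).hom.app X = σ.hom.app X := by
  classical
  obtain ⟨ι, hι, -, hdense, -⟩ := exists_completion_aut_forget (G := c.G)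
  obtain ⟨g, hg⟩ := hdense (transportAutIso c h𝒢 d hfin σ)
    (S.image fun X => chartFibreObj c h𝒢 hfin X)
  refine ⟨g, fun X hX => ?_⟩
  have hgY : ∀ y : (chartFibreObj c h𝒢 hfin X).obj.V,
      ConcreteCategory.hom ((chartFibreObj c h𝒢 hfin X).obj.ρ g) y =
        (transportAutIso c h𝒢 d hfin σ).hom.app (chartFibreObj c h𝒢 hfin X) y := fun y => by
    have h1 := hg (chartFibreObj c h𝒢 hfin X) (Finset.mem_image_of_mem _ hX)
    rw [hι] at h1
    exact ConcreteCategory.congr_hom h1 y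
  -- compare on the chart fibre of `chartToBObj (c X) ≅ X`
  apply ConcreteCategory.hom_ext
  intro x
  have hx : (chartFibre c h𝒢).map (chartToBObjObjIso c h𝒢 hfin d X).hom
      ((chartFibre c h𝒢).map (chartToBObjObjIso c h𝒢 hfin d X).inv x) = x :=
    ConcreteCategory.congr_hom ((chartToBObjObjIso c h𝒢 hfin d X).map_inv_hom_id (chartFibre c h𝒢)) x
  -- there: `J (g • x') = g • J x' = transportAut σ (J x') = J (σ x')`
  have key : ∀ z : (chartFibre c h𝒢).obj ((chartToBObj c d).obj (chartFibreObj c h𝒢 hfin X)),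
      (chartAction c h𝒢 g).hom.app _ z = σ.hom.app _ z := fun z => by
    have h1 : (chartFibreToBObjIso c h𝒢 d).hom.app _ ((chartAction c h𝒢 g).hom.app _ z) =
        (chartFibreToBObjIso c h𝒢 d).hom.app _ (σ.hom.app _
          ((chartFibreToBObjIso c h𝒢 d).inv.app _ ((chartFibreToBObjIso c h𝒢 d).hom.app _ z))) :=
      (chartFibreToBObjIso_equivariant c h𝒢 d g (chartFibreObj c h𝒢 hfin X) z).trans (hgY _)
    have h2 : (chartFibreToBObjIso c h𝒢 d).inv.app _ ((chartFibreToBObjIso c h𝒢 d).hom.app _ z) = z :=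
      Iso.hom_inv_id_app_apply (chartFibreToBObjIso c h𝒢 d) _ z
    rw [h2] at h1
    exact ((Iso.hom_inv_id_app_apply (chartFibreToBObjIso c h𝒢 d) _
        ((chartAction c h𝒢 g).hom.app _ z)).symm.trans
      ((congrArg ((chartFibreToBObjIso c h𝒢 d).inv.app (chartFibreObj c h𝒢 hfin X)) h1).trans
        (Iso.hom_inv_id_app_apply (chartFibreToBObjIso c h𝒢 d) _ (σ.hom.app _ z))))
  change (chartAction c h𝒢 g).hom.app X x = σ.hom.app X x
  calc (chartAction c h𝒢 g).hom.app X x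
      = (chartAction c h𝒢 g).hom.app X ((chartFibre c h𝒢).map (chartToBObjObjIso c h𝒢 hfin d X).hom
          ((chartFibre c h𝒢).map (chartToBObjObjIso c h𝒢 hfin d X).inv x)) := by rw [hx]
    _ = (chartFibre c h𝒢).map (chartToBObjObjIso c h𝒢 hfin d X).hom
          ((chartAction c h𝒢 g).hom.app _
            ((chartFibre c h𝒢).map (chartToBObjObjIso c h𝒢 hfin d X).inv x)) :=
        NatTrans.naturality_apply (chartAction c h𝒢 g).hom (chartToBObjObjIso c h𝒢 hfin d X).hom _
    _ = (chartFibre c h𝒢).map (chartToBObjObjIso c h𝒢 hfin d X).hom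
          (σ.hom.app _ ((chartFibre c h𝒢).map (chartToBObjObjIso c h𝒢 hfin d X).inv x)) :=
        congrArg _ (key _)
    _ = σ.hom.app X ((chartFibreFin c h𝒢 hfin).map (chartToBObjObjIso c h𝒢 hfin d X).hom
          ((chartFibre c h𝒢).map (chartToBObjObjIso c h𝒢 hfin d X).inv x)) :=
        (NatTrans.naturality_apply σ.hom (chartToBObjObjIso c h𝒢 hfin d X).hom _).symm
    _ = σ.hom.app X x := congrArg _ hx

/-! ### Assembly under the hypotheses of Proposition 3.6 -/

/-- Under the hypotheses of [SemiAnbd] Prop. 3.6 every chart carries a `ChartVertexDatum`: a vertex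
(`HasVertex`), connectedness, and a verticial homomorphism with its defining isomorphism (Thm. 3.7 (i),
`exists_isVerticialHom_of`, the temperoid input being `TemperoidHomEqRes_holds`).
[cite: MochizukiSemiAnbd2006, Thm 3.7(i) p.40] -/
theorem nonempty_chartVertexDatum (h36 : 𝒢.Prop36Hypotheses) (c : TemperedPiChart 𝒢) :
    Nonempty (ChartVertexDatum c) := by
  obtain ⟨v⟩ := h36.hasVertex
  obtain ⟨ψ, ⟨e⟩⟩ := exists_isVerticialHom_of c v (TemperoidHomEqRes_holds (𝒢.Gv v) c.G)
    h36.isQuasiCoherent h36.isGaloisCountable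
  exact ⟨⟨h36.isConnected, v, ψ, e⟩⟩

/-- Under the hypotheses of Prop. 3.6 finite objects are tempered (`FiniteIsTempered_holds`).
[cite: MochizukiSemiAnbd2006, Def 3.5(ii) p.37] -/
theorem isTempered_of_isFinite_of_prop36 (h36 : 𝒢.Prop36Hypotheses) :
    ∀ S : CovObj 𝒢, S.IsFinite → S.IsTempered :=
  isTempered_of_isFinite h36.isConnected h36.isCountable

/-- Under the hypotheses of Prop. 3.6 the chart fibres of finite étale coverings are finite.
[cite: MochizukiSemiAnbd2006, Prop 3.6(iii) p.38] -/
theorem finite_chartFibre_of_prop36 (h36 : 𝒢.Prop36Hypotheses) (X : 𝒢.toAnab.BObj) :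
    Finite ((chartFibre c h𝒢).obj X) := by
  obtain ⟨d⟩ := nonempty_chartVertexDatum h36 c
  exact finite_chartFibre c h𝒢 d.v d.ψ d.e X

/-- **[SemiAnbd] Proposition 3.6 (iii), profinite-completion form** ("the full embedding
`B(G) ↪ B^temp(G)` induces … `π₁^temp(G) → π̂₁(G)`", `π̂₁(G)` being the profinite completion): under the
hypotheses of Prop. 3.6, for every chart `c` of `π₁^temp(𝒢)`, the chart basepoint
`Φ = chartFibreFin c _ _` is a fibre functor of the Galois category `B(𝒢.toAnab)` and the homomorphism
`ι = chartActionFin : π₁^temp(𝒢) → Aut Φ (= π̂₁(B(𝒢)))` (acting by `ρ` through the chart,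
`chartActionFin_hom_app_apply`) is CONTINUOUS, has KERNEL the intersection of the open normal subgroups
of finite index, and has DENSE IMAGE.  (Injectivity is thus exactly the residual finiteness of
`π₁^temp(𝒢)`, `TemperedPiResiduallyFinite`.) [cite: MochizukiSemiAnbd2006, Prop 3.6(iii) p.38] -/
theorem exists_profiniteCompletion_chart (h36 : 𝒢.Prop36Hypotheses) (c : TemperedPiChart 𝒢) :
    letI := 𝒢.toAnab.preGaloisCategory_bObj
    ∃ hfin : ∀ X : 𝒢.toAnab.BObj,
        Finite ((chartFibre c (isTempered_of_isFinite_of_prop36 h36)).obj X),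
      Nonempty (FiberFunctor (chartFibreFin c (isTempered_of_isFinite_of_prop36 h36) hfin)) ∧
      Continuous (chartActionFin c (isTempered_of_isFinite_of_prop36 h36) hfin) ∧
      (∀ g : c.G, chartActionFin c (isTempered_of_isFinite_of_prop36 h36) hfin g = 1 ↔
        ∀ N : OpenNormalSubgroup c.G, Finite (c.G ⧸ N.toSubgroup) → g ∈ N.toSubgroup) ∧
      (∀ (σ : Aut (chartFibreFin c (isTempered_of_isFinite_of_prop36 h36) hfin))
        (S : Finset 𝒢.toAnab.BObj), ∃ g : c.G, ∀ X ∈ S,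
          (chartActionFin c (isTempered_of_isFinite_of_prop36 h36) hfin g).hom.app X = σ.hom.app X) := by
  letI := 𝒢.toAnab.preGaloisCategory_bObj
  obtain ⟨d⟩ := nonempty_chartVertexDatum h36 c
  have hfin : ∀ X : 𝒢.toAnab.BObj,
      Finite ((chartFibre c (isTempered_of_isFinite_of_prop36 h36)).obj X) :=
    fun X => finite_chartFibre c _ d.v d.ψ d.e X
  exact ⟨hfin, nonempty_fiberFunctor_chartFibreFin c _ hfin ⟨h36.isConnected⟩ d.v d.ψ d.e,
    continuous_chartActionFin c _ hfin, fun g => chartActionFin_eq_one_iff c _ d hfin g,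
    fun σ S => chartActionFin_dense c _ d hfin σ S⟩

end ProfiniteSemiGraph

end Literature.AnabelianGeometry.SemiGraphs

end
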